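import Literature.MathematicalPhysics.KineticTheory.EvenStatTruncationBound
import Literature.MathematicalPhysics.KineticTheory.HardSphereEulerProofs
import Summits.AtomisticToContinuum.HydrodynamicLimit.Theorems.ImplosionDichotomyHsEosLowDensity
import HarnessLib

/-!
# S1 of the line `even-rung-mean-variance` from the two velocity-tail inputs
# (`stub_velocityTruncationOfTails`, crux `JParityClosure.EvenStressEnskog`, stmt-AtomisticToContinuum-13079)

The registered stub S1 (`stub_velocityTruncation`) asks that the crux statistic
`D(Ξ) = evenStat σ N Φ τ χ g Ξ r = K_N[χ g(σ³ρ_r) Ξ] − σ³ ∫₀^τ e_s(Ξ)(Φ_s ·) ds` change little, in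
probability under the local Gibbs law, when the velocity-unbounded momentum-transfer mark
`Ξ_P^{kl} = evenMark k l` is replaced by its truncation `Ξ_L^{kl} = evenMarkTrunc k l L`
(`L → ∞` after `N → ∞`, `L₀ = L₀(r)`).  For general profiles at positive times this is uniform
integrability of the kinetic energy along the deterministic flow — open.  The helper stub
`stub_velocityTruncationOfTails` proved here is the REDUCTION of S1 to the two a-priori inputs, stated
as its two antecedents:

* **(H_K)** the collision sum `K_N[1 · g(σ³ρ_r) · m_L]` of the speed-tail mark
  `m_L = speedTailMark L` (`CollisionTailMarks`), for continuous nonnegative cutoffs `g` vanishing on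
  `[η₀, ∞)`, is small in probability (`∀ η δ ∃ r₀ ∀ r ∃ L₀ ∀ L ∃ N₀ ∀ N`);
* **(H_E)** the fixed-time means `∫ T_L(Φ_s z) dLG_N` of the tail kinetic energy per particle
  `T_L = tailEnergy L` are small uniformly on `[0, τ]` (`∀ η ∃ L₀ ∀ L ∃ N₀ ∀ N ∀ s ∈ [0, τ]`).

Proof.  Finite-`N` core: `measure_lt_abs_evenStat_sub_le` of `EvenStatTruncationBound`
(`P{η < |D(Ξ_P) − D(Ξ_L)|} ≤ P{η/2 < C_χ K_N[1,|g|,m_L]} + P{η/2 < σ³C_E ∫₀^τ T_L(Φ_s ·)}`,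
`C_E = C_χ C_{gY}(3/πr³)²8|S²|`).  The contact value `Y` is bounded on a band `[0, ηY]` by the PROVED
equation of state `hsEosLowDensity_proof` (`exists_contactValue_bound`: `Y = (3/2π)F′` on the open
band, `F′` continuous; the junk `Y 0` is bounded by itself), which fixes `η₀ = min ηK ηY` and
`|g·Y| ≤ C_{gY}` on `[0, ∞)`; Markov plus Tonelli for the jointly measurable piecewise flow
(`measure_lt_setIntegral_flow_le`) turns (H_E) into the second event bound; thresholds
`σ₀ = min σK σE ½`, (H_K) run with the cutoff `|g|` at `(η/(2C_χ), δ/2)`, (H_E) at `ηδ/(4c′τ)`,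
`c′ = σ³C_E + 1`, `L₀ = max L₀ᴷ L₀ᴱ 1`, `N₀ = max` (`velocityTruncation_of_tails_at`, profile by
profile — the form in which rung 0 closes).

References: H. Spohn, *Large Scale Dynamics of Interacting Particles* (1991), Part I §2–3;
Chapman–Cowling (1970) Ch. 16.
-/

noncomputable section

open MeasureTheory Set Filter Topology
open scoped ENNReal InnerProductSpace BigOperators

namespace Summit.AtomisticToContinuum.HydrodynamicLimit.Theorems.EvenStressEnskog

open Literature.Analysis.FluidPDE Literature.MathematicalPhysics.KineticTheory

/-! ## Markov's inequality for a time-integrated nonnegative observable along the flow -/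

open scoped Classical in
/-- **Markov for a time-integrated nonnegative observable along the flow.**  If `f ≥ 0` is measurable,
integrable in time along good orbits on `[0, τ]`, and its fixed-time means under the evolved law are
`≤ λ` on `[0, τ]` (`∫⁻ f(Φ_s z) dP ≤ λ`, `λ ≥ 0`), then `P{c < ∫₀^τ f(Φ_s z) ds} ≤ τλ/c` (`c > 0`) —
Tonelli for the jointly measurable piecewise flow (`measurable_piecewise_flow_torus`), which is the
flow `P`-a.e. (`localGibbsLaw_compl_good_eq_zero`). [folklore] -/
theorem measure_lt_setIntegral_flow_le {σ : ℝ} {a₀ θ₀ : T3 → ℝ} {u₀ : T3 → V3} {N : ℕ}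
    (Φ : HardSphereFlow (Torus.geometry (Fin 3)) (hsDiameter σ N) (N + 1))
    [SFinite (localGibbsLaw σ a₀ u₀ θ₀ N Φ)]
    {f : Config (N + 1) (Fin 3) T3 → ℝ} (hf : Measurable f) (hf0 : ∀ z, 0 ≤ f z) {τ lam c : ℝ}
    (hfi : ∀ z ∈ Φ.good, IntegrableOn (fun s => f (Φ.flow s z)) (Icc 0 τ))
    (hlam : 0 ≤ lam) (hc : 0 < c)
    (hmean : ∀ s ∈ Icc (0 : ℝ) τ,
      ∫⁻ z, ENNReal.ofReal (f (Φ.flow s z)) ∂(localGibbsLaw σ a₀ u₀ θ₀ N Φ) ≤ ENNReal.ofReal lam) :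
    localGibbsLaw σ a₀ u₀ θ₀ N Φ {z | c < ∫ s in Icc (0 : ℝ) τ, f (Φ.flow s z)}
      ≤ ENNReal.ofReal (τ * lam / c) := by
  set P := localGibbsLaw σ a₀ u₀ θ₀ N Φ with hP
  have hae : ∀ᵐ z ∂P, z ∈ Φ.good := mem_ae_iff.2 (localGibbsLaw_compl_good_eq_zero Φ)
  have hG : Measurable fun p : ℝ × Config (N + 1) (Fin 3) T3 =>
      ENNReal.ofReal (f (Φ.good.piecewise (Φ.flow p.1) id p.2)) :=
    (hf.comp (measurable_piecewise_flow_torus Φ)).ennreal_ofReal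
  set F : Config (N + 1) (Fin 3) T3 → ℝ≥0∞ := fun z =>
    ∫⁻ s in Icc (0 : ℝ) τ, ENNReal.ofReal (f (Φ.good.piecewise (Φ.flow s) id z)) with hF
  have hFm : Measurable F := hG.lintegral_prod_left'
  have hFeq : ∀ z ∈ Φ.good, F z = ∫⁻ s in Icc (0 : ℝ) τ, ENNReal.ofReal (f (Φ.flow s z)) := by
    intro z hz
    simp only [hF, piecewise_flow_of_mem Φ _ hz]
  have hsub : {z | c < ∫ s in Icc (0 : ℝ) τ, f (Φ.flow s z)} ∩ Φ.good ⊆ {z | ENNReal.ofReal c ≤ F z} := by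
    rintro z ⟨hz, hzg⟩
    simp only [mem_setOf_eq] at hz ⊢
    rw [hFeq z hzg, ← ofReal_integral_eq_lintegral_ofReal (hfi z hzg) (ae_of_all _ fun s => hf0 _)]
    exact ENNReal.ofReal_le_ofReal hz.le
  have hTon : ∫⁻ z, F z ∂P ≤ ENNReal.ofReal lam * ENNReal.ofReal τ := by
    calc ∫⁻ z, F z ∂P
        = ∫⁻ s in Icc (0 : ℝ) τ, ∫⁻ z, ENNReal.ofReal (f (Φ.good.piecewise (Φ.flow s) id z)) ∂P := by
          rw [hF]
          exact lintegral_lintegral_swap (hG.comp measurable_swap).aemeasurable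
      _ = ∫⁻ s in Icc (0 : ℝ) τ, ∫⁻ z, ENNReal.ofReal (f (Φ.flow s z)) ∂P := by
          refine lintegral_congr fun s => lintegral_congr_ae ?_
          filter_upwards [hae] with z hz
          rw [piecewise_flow_of_mem Φ s hz]
      _ ≤ ∫⁻ _s in Icc (0 : ℝ) τ, ENNReal.ofReal lam :=
          setLIntegral_mono measurable_const fun s hs => hmean s hs
      _ = ENNReal.ofReal lam * ENNReal.ofReal τ := by
          rw [setLIntegral_const, Real.volume_Icc, sub_zero]
  have hc' : ENNReal.ofReal c ≠ 0 := by simpa using hc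
  calc P {z | c < ∫ s in Icc (0 : ℝ) τ, f (Φ.flow s z)}
      ≤ P ({z | c < ∫ s in Icc (0 : ℝ) τ, f (Φ.flow s z)} ∩ Φ.good ∪ Φ.goodᶜ) := by
        refine measure_mono fun z hz => ?_
        by_cases hzg : z ∈ Φ.good
        · exact Or.inl ⟨hz, hzg⟩
        · exact Or.inr hzg
    _ ≤ P ({z | c < ∫ s in Icc (0 : ℝ) τ, f (Φ.flow s z)} ∩ Φ.good) + P Φ.goodᶜ := measure_union_le _ _
    _ = P ({z | c < ∫ s in Icc (0 : ℝ) τ, f (Φ.flow s z)} ∩ Φ.good) := by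
        rw [hP, localGibbsLaw_compl_good_eq_zero, add_zero]
    _ ≤ P {z | ENNReal.ofReal c ≤ F z} := measure_mono hsub
    _ ≤ (∫⁻ z, F z ∂P) / ENNReal.ofReal c := meas_ge_le_lintegral_div hFm.aemeasurable hc' ENNReal.ofReal_ne_top
    _ ≤ (ENNReal.ofReal lam * ENNReal.ofReal τ) / ENNReal.ofReal c := ENNReal.div_le_div_right hTon _
    _ = ENNReal.ofReal (τ * lam / c) := by
        rw [← ENNReal.ofReal_mul hlam, ENNReal.ofReal_div_of_pos hc, mul_comm τ lam]

/-! ## The contact value at low density -/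

/-- **The contact value is bounded on a low-density band** `[0, η₁]`: by the equation of state at low
density (`hsEosLowDensity_proof`, PROVED in the tree: `f_ex = F` on `[0, η₀)` with `F` analytic on
`(−η₀, η₀)`), `Y = (3/2π) F′` on the OPEN band `(0, η₀)` (`Filter.EventuallyEq.deriv_eq`), where `F′`
is continuous; the junk value `Y 0` is bounded by itself.  No regularity of `Y` at `0` is claimed.
[folklore] -/
theorem exists_contactValue_bound :
    ∃ η₁ : ℝ, 0 < η₁ ∧ ∃ CY : ℝ, ∀ a ∈ Icc (0 : ℝ) η₁, |contactValue a| ≤ CY := by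
  obtain ⟨η₀, hη₀, F, hF, hEq, -, -, -⟩ := hsEosLowDensity_proof
  have hdF : ContinuousOn (deriv F) (Ioo (-η₀) η₀) := hF.deriv.continuousOn
  have hsub : Icc (0 : ℝ) (η₀ / 2) ⊆ Ioo (-η₀) η₀ := fun a ha => ⟨by linarith [ha.1], by linarith [ha.2]⟩
  obtain ⟨C, hC⟩ := (isCompact_Icc (a := (0 : ℝ)) (b := η₀ / 2)).exists_bound_of_continuousOn
    (hdF.mono hsub)
  refine ⟨η₀ / 2, by positivity, max (3 / (2 * Real.pi) * C) |contactValue 0|, fun a ha => ?_⟩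
  rcases ha.1.eq_or_lt with h0 | hpos
  · rw [← h0]
    exact le_max_right _ _
  · have hev : hsExcessFreeEnergy =ᶠ[𝓝 a] F := by
      have hmem : Ioo (0 : ℝ) η₀ ∈ 𝓝 a := Ioo_mem_nhds hpos (by linarith [ha.2])
      filter_upwards [hmem] with b hb
      exact hEq ⟨hb.1.le, hb.2⟩
    refine le_trans ?_ (le_max_left _ _)
    unfold contactValue
    rw [hev.deriv_eq, abs_mul, abs_of_nonneg (by positivity : (0 : ℝ) ≤ 3 / (2 * Real.pi))]
    refine mul_le_mul_of_nonneg_left ?_ (by positivity)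
    have := hC a ha
    rwa [Real.norm_eq_abs] at this

/-! ## The reduction, profile by profile -/

/-- **S1 from (H_K) and (H_E), profile by profile.**  For fixed continuous positive profiles, the
per-profile bodies of (H_K) (the collision tail, with cutoff threshold `ηK`) and of (H_E) (the energy
tail), together with a bound `|Y| ≤ CY` on a band `[0, ηY]`, give the per-profile body
of the registered stub S1 with cutoff threshold `min ηK ηY`.  Thresholds: `σ₀ = min σK σE ½`; given
`(η, δ)`: `C_χ = max(sup|χ|, 1)` on `[0,τ] × 𝕋³`, `C_{gY} = max(sup|g|·CY, 1)`, (H_K) is run with the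
cutoff `|g|` at `(η/(2C_χ), δ/2)` giving `r₀` and `L₀ᴷ(r)`, (H_E) at mean accuracy `ηδ/(4c′τ)`,
`c′ = σ³C_E + 1`, `C_E = C_χ C_{gY} (3/πr³)² 8|S²|`, giving `L₀ᴱ(r)`; `L₀ = max L₀ᴷ L₀ᴱ 1`, `N₀ = max`;
then `measure_lt_abs_evenStat_sub_le` and Markov (`measure_lt_setIntegral_flow_le`).  This is the form
in which RUNG 0 closes: constant profiles, `velocityTailEnergy_rung0` for (H_E), and the rung-0
collision tail. [folklore] -/
theorem velocityTruncation_of_tails_at {ηK ηY CY : ℝ} {a₀ θ₀ : T3 → ℝ} {u₀ : T3 → V3}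
    (ha : Continuous a₀) (hθ : Continuous θ₀) (hu : Continuous u₀) (ha0 : ∀ x, 0 < a₀ x)
    (hθ0 : ∀ x, 0 < θ₀ x) (hηY : 0 < ηY) (hCY : ∀ a ∈ Icc (0 : ℝ) ηY, |contactValue a| ≤ CY)
    (hK : ∃ σ₀ : ℝ, 0 < σ₀ ∧ ∀ σ : ℝ, 0 < σ → σ < σ₀ →
      ∀ Φ : (N : ℕ) → HardSphereFlow (Torus.geometry (Fin 3)) (hsDiameter σ N) (N + 1),
      ∀ τ : ℝ, 0 < τ → ∀ g : ℝ → ℝ, Continuous g → (∀ a, ηK ≤ a → g a = 0) → (∀ a, 0 ≤ g a) →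
      ∀ η δ : ℝ, 0 < η → 0 < δ → ∃ r₀ : ℝ, 0 < r₀ ∧ ∀ r : ℝ, 0 < r → r < r₀ →
      ∃ L₀ : ℝ, ∀ L : ℝ, L₀ ≤ L → ∃ N₀ : ℕ, ∀ N : ℕ, N₀ ≤ N →
        localGibbsLaw σ a₀ u₀ θ₀ N (Φ N)
          {z | η < collisionSum σ N (Φ N) τ (fun _ => 1) g (speedTailMark L) r z} ≤ ENNReal.ofReal δ)
    (hE : ∃ σ₀ : ℝ, 0 < σ₀ ∧ ∀ σ : ℝ, 0 < σ → σ < σ₀ →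
      ∀ Φ : (N : ℕ) → HardSphereFlow (Torus.geometry (Fin 3)) (hsDiameter σ N) (N + 1),
      ∀ τ : ℝ, 0 < τ → ∀ η : ℝ, 0 < η → ∃ L₀ : ℝ, ∀ L : ℝ, L₀ ≤ L → ∃ N₀ : ℕ, ∀ N : ℕ, N₀ ≤ N →
      ∀ s ∈ Icc (0 : ℝ) τ,
        ∫⁻ z, ENNReal.ofReal (tailEnergy L ((Φ N).flow s z)) ∂(localGibbsLaw σ a₀ u₀ θ₀ N (Φ N))
          ≤ ENNReal.ofReal η) :
    ∃ σ₀ : ℝ, 0 < σ₀ ∧ ∀ σ : ℝ, 0 < σ → σ < σ₀ →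
      ∀ Φ : (N : ℕ) → HardSphereFlow (Torus.geometry (Fin 3)) (hsDiameter σ N) (N + 1),
      ∀ τ : ℝ, 0 < τ → ∀ χ : ℝ × UnitAddTorus (Fin 3) → ℝ, Continuous χ → ∀ g : ℝ → ℝ, Continuous g →
      (∀ a, min ηK ηY ≤ a → g a = 0) →
      ∀ η δ : ℝ, 0 < η → 0 < δ → ∃ r₀ : ℝ, 0 < r₀ ∧ ∀ r : ℝ, 0 < r → r < r₀ →
      ∃ L₀ : ℝ, ∀ L : ℝ, L₀ ≤ L → ∃ N₀ : ℕ, ∀ N : ℕ, N₀ ≤ N → ∀ k l : Fin 3,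
        localGibbsLaw σ a₀ u₀ θ₀ N (Φ N)
          {z | η < |evenStat σ N (Φ N) τ χ g (evenMark k l) r z -
              evenStat σ N (Φ N) τ χ g (evenMarkTrunc k l L) r z|}
          ≤ ENNReal.ofReal δ := by
  obtain ⟨σK, hσK, HK⟩ := hK
  obtain ⟨σE, hσE, HE⟩ := hE
  refine ⟨min (min σK σE) (1 / 2), lt_min (lt_min hσK hσE) (by norm_num), ?_⟩
  intro σ hσ hσlt Φ τ hτ χ hχ g hg hg0 η δ hη hδ
  have hσK' : σ < σK := lt_of_lt_of_le hσlt ((min_le_left _ _).trans (min_le_left _ _))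
  have hσE' : σ < σE := lt_of_lt_of_le hσlt ((min_le_left _ _).trans (min_le_right _ _))
  have hσhalf : σ ≤ 1 / 2 := (lt_of_lt_of_le hσlt (min_le_right _ _)).le
  -- the bound of `χ` on `[0, τ] × 𝕋³`
  obtain ⟨Cχ', hCχ'⟩ := (isCompact_Icc.prod isCompact_univ :
    IsCompact (Icc (0 : ℝ) τ ×ˢ (univ : Set (UnitAddTorus (Fin 3))))).exists_bound_of_continuousOn
      hχ.continuousOn
  set Cχ := max Cχ' 1 with hCχdef
  have hχb : ∀ s ∈ Icc (0 : ℝ) τ, ∀ x, |χ (s, x)| ≤ Cχ := fun s hs x => by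
    have := hCχ' (s, x) ⟨hs, mem_univ _⟩
    rw [Real.norm_eq_abs] at this
    exact this.trans (le_max_left _ _)
  have hCχ1 : 1 ≤ Cχ := le_max_right _ _
  have hCχ0 : 0 < Cχ := one_pos.trans_le hCχ1
  -- the bound of `g` on `[0, ∞)` and of `g · Y`
  obtain ⟨Cg', hCg'⟩ := (isCompact_Icc (a := (0 : ℝ)) (b := min ηK ηY)).exists_bound_of_continuousOn
    hg.continuousOn
  have hgb : ∀ a, 0 ≤ a → |g a| ≤ max Cg' 0 := by
    intro a ha0'
    by_cases h : a ≤ min ηK ηY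
    · have := hCg' a ⟨ha0', h⟩
      rw [Real.norm_eq_abs] at this
      exact this.trans (le_max_left _ _)
    · rw [hg0 a (le_of_not_ge h), abs_zero]
      exact le_max_right _ _
  have hCY0 : 0 ≤ CY := (abs_nonneg _).trans (hCY 0 ⟨le_rfl, hηY.le⟩)
  set CgY := max (max Cg' 0 * CY) 1 with hCgYdef
  have hgY : ∀ a, 0 ≤ a → |g a * contactValue a| ≤ CgY := by
    intro a ha0'
    by_cases h : a ≤ ηY
    · rw [abs_mul]
      exact (mul_le_mul (hgb a ha0') (hCY a ⟨ha0', h⟩) (abs_nonneg _) (le_max_right _ _)).trans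
        (le_max_left _ _)
    · have : g a = 0 := hg0 a ((min_le_right _ _).trans (le_of_not_ge h))
      rw [this, zero_mul, abs_zero]
      exact zero_le_one.trans (le_max_right _ _)
  have hCgY1 : 1 ≤ CgY := le_max_right _ _
  -- the collision input with the cutoff `|g|`
  have hg' : Continuous fun a => |g a| := hg.abs
  have hg'0 : ∀ a, ηK ≤ a → (fun a => |g a|) a = 0 := fun a h => by
    show |g a| = 0
    rw [hg0 a ((min_le_left _ _).trans h), abs_zero]
  have hg'nn : ∀ a, 0 ≤ (fun a => |g a|) a := fun a => abs_nonneg _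
  obtain ⟨r₀, hr₀, HK⟩ := HK σ hσ hσK' Φ τ hτ (fun a => |g a|) hg' hg'0 hg'nn (η / (2 * Cχ)) (δ / 2)
    (by positivity) (by positivity)
  refine ⟨r₀, hr₀, fun r hr hrlt => ?_⟩
  obtain ⟨LK, HK⟩ := HK r hr hrlt
  -- the energy input
  set CE := Cχ * CgY * ((3 / (Real.pi * r ^ 3)) ^ 2 *
    (8 * sphereMeasure.real (univ : Set (Metric.sphere (0 : V3) 1)))) with hCEdef
  have hCE0 : 0 ≤ CE := by
    have : 0 ≤ sphereMeasure.real (univ : Set (Metric.sphere (0 : V3) 1)) := measureReal_nonneg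
    positivity
  set c' := σ ^ 3 * CE + 1 with hc'def
  have hc'0 : 0 < c' := by positivity
  obtain ⟨LE, HE⟩ := HE σ hσ hσE' Φ τ hτ (η * δ / (4 * c' * τ)) (by positivity)
  refine ⟨max LK (max LE 1), fun L hL => ?_⟩
  have hLK : LK ≤ L := (le_max_left _ _).trans hL
  have hLE : LE ≤ L := ((le_max_left _ _).trans (le_max_right _ _)).trans hL
  have hL0 : 0 < L := one_pos.trans_le (((le_max_right _ _).trans (le_max_right _ _)).trans hL)
  obtain ⟨NK, HK⟩ := HK L hLK
  obtain ⟨NE, HE⟩ := HE L hLE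
  refine ⟨max NK NE, fun N hN k l => ?_⟩
  have hNK : NK ≤ N := (le_max_left _ _).trans hN
  have hNE : NE ≤ N := (le_max_right _ _).trans hN
  haveI hPN : IsProbabilityMeasure (localGibbsLaw σ a₀ u₀ θ₀ N (Φ N)) :=
    isProbabilityMeasure_localGibbsLaw ha hθ hu ha0 hθ0 hσhalf N (Φ N)
  set P := localGibbsLaw σ a₀ u₀ θ₀ N (Φ N) with hP
  have main := measure_lt_abs_evenStat_sub_le (a₀ := a₀) (θ₀ := θ₀) (u₀ := u₀) (Φ N) hχ hg hχb hgY hσ hr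
    hL0 η k l
  -- the collision event
  have hKev : P {z | η / 2 < Cχ * collisionSum σ N (Φ N) τ (fun _ => 1) (fun a => |g a|) (speedTailMark L) r z}
      ≤ ENNReal.ofReal (δ / 2) := by
    refine le_trans (measure_mono fun z hz => ?_) (HK N hNK)
    simp only [mem_setOf_eq] at hz ⊢
    rw [div_lt_iff₀ (by positivity)]
    nlinarith
  -- the energy event
  have hEev : P {z | η / 2 < σ ^ 3 * CE * ∫ s in Icc (0 : ℝ) τ, tailEnergy L ((Φ N).flow s z)}
      ≤ ENNReal.ofReal (δ / 2) := by
    have hincl : {z | η / 2 < σ ^ 3 * CE * ∫ s in Icc (0 : ℝ) τ, tailEnergy L ((Φ N).flow s z)} ⊆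
        {z | η / (2 * c') < ∫ s in Icc (0 : ℝ) τ, tailEnergy L ((Φ N).flow s z)} := by
      intro z hz
      simp only [mem_setOf_eq] at hz ⊢
      have hI : 0 ≤ ∫ s in Icc (0 : ℝ) τ, tailEnergy L ((Φ N).flow s z) :=
        setIntegral_nonneg measurableSet_Icc fun s _ => tailEnergy_nonneg L _
      rw [div_lt_iff₀ (by positivity)]
      have : σ ^ 3 * CE * ∫ s in Icc (0 : ℝ) τ, tailEnergy L ((Φ N).flow s z) ≤
          c' * ∫ s in Icc (0 : ℝ) τ, tailEnergy L ((Φ N).flow s z) :=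
        mul_le_mul_of_nonneg_right (by rw [hc'def]; linarith) hI
      nlinarith
    have hMarkov := measure_lt_setIntegral_flow_le (a₀ := a₀) (θ₀ := θ₀) (u₀ := u₀) (Φ N)
      (measurable_tailEnergy L) (tailEnergy_nonneg L)
      (fun z hz => integrableOn_tailEnergy_flow (Φ N) hz L τ) (by positivity : 0 ≤ η * δ / (4 * c' * τ))
      (by positivity : 0 < η / (2 * c')) (HE N hNE)
    refine ((measure_mono hincl).trans hMarkov).trans (le_of_eq ?_)
    congr 1
    field_simp
    ring
  calc P {z | η < |evenStat σ N (Φ N) τ χ g (evenMark k l) r z -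
          evenStat σ N (Φ N) τ χ g (evenMarkTrunc k l L) r z|}
      ≤ _ := main
    _ ≤ ENNReal.ofReal (δ / 2) + ENNReal.ofReal (δ / 2) := add_le_add hKev hEev
    _ = ENNReal.ofReal δ := by
        rw [← ENNReal.ofReal_add (by positivity) (by positivity), add_halves]

/-! ## The registered helper stub -/

/-- **S1 ⇐ collision speed tail ∧ energy tail** (registered helper stub
`stub_velocityTruncationOfTails` of the line `even-rung-mean-variance`, verbatim): the registered
signature of S1 (`stub_velocityTruncation`) follows from (H_K) — its first antecedent — and (H_E) —
its second antecedent.  `η₀ = min ηK ηY` with `ηY` the band of `exists_contactValue_bound`, then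
`velocityTruncation_of_tails_at` profile by profile. [folklore] -/
theorem stub_velocityTruncationOfTails :
    (∃ η₀ : ℝ, 0 < η₀ ∧ ∀ (a₀ θ₀ : T3 → ℝ) (u₀ : T3 → V3), Continuous a₀ → Continuous θ₀ → Continuous u₀ →
      (∀ x, 0 < a₀ x) → (∀ x, 0 < θ₀ x) → ∃ σ₀ : ℝ, 0 < σ₀ ∧ ∀ σ : ℝ, 0 < σ → σ < σ₀ → ∀ Φ : (N : ℕ) →
      HardSphereFlow (Torus.geometry (Fin 3)) (hsDiameter σ N) (N + 1), ∀ τ : ℝ, 0 < τ → ∀ g : ℝ → ℝ,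
      Continuous g → (∀ a, η₀ ≤ a → g a = 0) → (∀ a, 0 ≤ g a) → ∀ η δ : ℝ, 0 < η → 0 < δ → ∃ r₀ : ℝ,
      0 < r₀ ∧ ∀ r : ℝ, 0 < r → r < r₀ → ∃ L₀ : ℝ, ∀ L : ℝ, L₀ ≤ L → ∃ N₀ : ℕ, ∀ N : ℕ, N₀ ≤ N →
      localGibbsLaw σ a₀ u₀ θ₀ N (Φ N) {z | η < collisionSum σ N (Φ N) τ (fun _ => 1) g (speedTailMark L)
      r z} ≤ ENNReal.ofReal δ) → (∀ (a₀ θ₀ : T3 → ℝ) (u₀ : T3 → V3), Continuous a₀ → Continuous θ₀ →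
      Continuous u₀ → (∀ x, 0 < a₀ x) → (∀ x, 0 < θ₀ x) → ∃ σ₀ : ℝ, 0 < σ₀ ∧ ∀ σ : ℝ, 0 < σ → σ < σ₀ →
      ∀ Φ : (N : ℕ) → HardSphereFlow (Torus.geometry (Fin 3)) (hsDiameter σ N) (N + 1), ∀ τ : ℝ, 0 < τ →
      ∀ η : ℝ, 0 < η → ∃ L₀ : ℝ, ∀ L : ℝ, L₀ ≤ L → ∃ N₀ : ℕ, ∀ N : ℕ, N₀ ≤ N → ∀ s ∈ Set.Icc (0 : ℝ) τ,
      ∫⁻ z, ENNReal.ofReal (tailEnergy L ((Φ N).flow s z)) ∂(localGibbsLaw σ a₀ u₀ θ₀ N (Φ N)) ≤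
      ENNReal.ofReal η) → ∃ η₀ : ℝ, 0 < η₀ ∧ ∀ (a₀ θ₀ : T3 → ℝ) (u₀ : T3 → V3), Continuous a₀ →
      Continuous θ₀ → Continuous u₀ → (∀ x, 0 < a₀ x) → (∀ x, 0 < θ₀ x) → ∃ σ₀ : ℝ, 0 < σ₀ ∧ ∀ σ : ℝ,
      0 < σ → σ < σ₀ → ∀ Φ : (N : ℕ) → HardSphereFlow (Torus.geometry (Fin 3)) (hsDiameter σ N) (N + 1),
      ∀ τ : ℝ, 0 < τ → ∀ χ : ℝ × UnitAddTorus (Fin 3) → ℝ, Continuous χ → ∀ g : ℝ → ℝ, Continuous g →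
      (∀ a, η₀ ≤ a → g a = 0) → ∀ η δ : ℝ, 0 < η → 0 < δ → ∃ r₀ : ℝ, 0 < r₀ ∧ ∀ r : ℝ, 0 < r → r < r₀ →
      ∃ L₀ : ℝ, ∀ L : ℝ, L₀ ≤ L → ∃ N₀ : ℕ, ∀ N : ℕ, N₀ ≤ N → ∀ k l : Fin 3,
      localGibbsLaw σ a₀ u₀ θ₀ N (Φ N) {z | η < |evenStat σ N (Φ N) τ χ g (evenMark k l) r z - evenStat σ
      N (Φ N) τ χ g (evenMarkTrunc k l L) r z|} ≤ ENNReal.ofReal δ := by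
  intro hK hE
  obtain ⟨ηK, hηK, HK⟩ := hK
  obtain ⟨ηY, hηY, CY, hCY⟩ := exists_contactValue_bound
  refine ⟨min ηK ηY, lt_min hηK hηY, ?_⟩
  intro a₀ θ₀ u₀ ha hθ hu ha0 hθ0
  exact velocityTruncation_of_tails_at ha hθ hu ha0 hθ0 hηY hCY (HK a₀ θ₀ u₀ ha hθ hu ha0 hθ0)
    (hE a₀ θ₀ u₀ ha hθ hu ha0 hθ0)

end Summit.AtomisticToContinuum.HydrodynamicLimit.Theorems.EvenStressEnskog

end
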